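import Summits.AtomisticToContinuum.HydrodynamicLimit.Theorems.AntiMazurCoboundariesCellForecastPressureDecayEntropyBallObjects
import Literature.MathematicalPhysics.KineticTheory.HardSphereBBGKYLiouvilleFlow
import Literature.MathematicalPhysics.KineticTheory.HardSphereEulerProofs
import HarnessLib

/-!
# Stub `stub_torusGibbsInvariant` of the crux line `entropy-ball-invariant-states`
(crux `AntiMazurCoboundaries.CellForecastPressureDecay`, stmt-AtomisticToContinuum-13915)

Helper file of the line (`--supports stmt-AtomisticToContinuum-13915`): the torus canonical Gibbs law
`torusGibbs ε n Φ = particleLaw Φ (canonicalDensity 𝕋³ ε n (M ∘ snd))` is invariant under `Φ.flow t` for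
EVERY diameter `ε`, particle number `n`, torus hard-sphere flow `Φ` and time `t` (`TorusGibbsInvariance`).
Liouville's theorem (`HardSphereFlow.measurePreserving`) plus invariance of the density
`𝒵⁻¹ 𝟙_{D_ε} ∏ᵢ M(vᵢ) = 𝒵⁻¹ 𝟙_{D_ε} (2π)^{-3n/2} exp(−E(z))` on the conull good set (kinetic-energy
conservation `HardSphereFlow.configEnergy_flow`, `good ⊆ D_ε` mapped to itself). No positivity hypothesis
(if `𝒵 = 0` both sides are `0`). Pattern: `BoltzmannGreenKuboOrthMomentum.map_flow_localGibbsLaw_const`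
(`Theorems/BoltzmannGreenKubo/Negative/Stationarity.lean`), with the diameter and the particle number free.
-/

noncomputable section

open MeasureTheory ProbabilityTheory Set Filter Topology
open scoped ENNReal Classical

namespace Summit.AtomisticToContinuum.HydrodynamicLimit.Theorems.EntropyBall

open Literature.MathematicalPhysics.KineticTheory (T3 V3)
open Literature.Analysis.FluidPDE (HardSphereFlow Config canonicalDensity particleLaw globalMaxwellian
  tensorPow configEnergy liouville particleLaw_eq continuous_globalMaxwellian)

section TorusGibbsInvariant

/-- Closed form of the tensor power of the global Maxwellian (in the velocity variable): a constant times
`exp(−E(z))`, `E(z) = ½ Σᵢ ‖vᵢ‖²` the kinetic energy. -/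
theorem tensorPow_globalMaxwellian_snd (n : ℕ) (z : TorusPhase n) :
    tensorPow n (fun p : T3 × V3 => globalMaxwellian p.2) z =
      ((2 * Real.pi) ^ (-(Module.finrank ℝ V3 : ℝ) / 2)) ^ n * Real.exp (-configEnergy z) := by
  -- adapted from `BoltzmannGreenKuboOrthMomentum.tensorPow_localGibbsProfile_const`
  simp only [tensorPow, globalMaxwellian, configEnergy]
  rw [Finset.prod_mul_distrib, Finset.prod_const, Finset.card_univ, Fintype.card_fin, ← Real.exp_sum]
  congr 2
  rw [Finset.mul_sum, ← Finset.sum_neg_distrib]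
  refine Finset.sum_congr rfl fun i _ => ?_
  ring

/-- **The Maxwellian tensor power is invariant along every torus hard-sphere flow on its good set**
(kinetic-energy conservation `HardSphereFlow.configEnergy_flow`). -/
theorem tensorPow_globalMaxwellian_snd_flow {ε : ℝ} {n : ℕ} (Φ : TorusFlow ε n)
    {z : TorusPhase n} (hz : z ∈ Φ.good) (t : ℝ) :
    tensorPow n (fun p : T3 × V3 => globalMaxwellian p.2) (Φ.flow t z) =
      tensorPow n (fun p : T3 × V3 => globalMaxwellian p.2) z := by
  rw [tensorPow_globalMaxwellian_snd, tensorPow_globalMaxwellian_snd, Φ.configEnergy_flow hz t]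

/-- The torus canonical density with Maxwellian velocities is invariant along every torus hard-sphere
flow on its good set (`good ⊆ D_ε` is mapped to itself, so the hard-core indicator is `1` before and
after). -/
theorem canonicalDensity_globalMaxwellian_flow {ε : ℝ} {n : ℕ} (Φ : TorusFlow ε n)
    {z : TorusPhase n} (hz : z ∈ Φ.good) (t : ℝ) :
    canonicalDensity (Literature.Analysis.FluidPDE.Torus.geometry (Fin 3)) ε n
        (fun p : T3 × V3 => globalMaxwellian p.2) (Φ.flow t z) =
      canonicalDensity (Literature.Analysis.FluidPDE.Torus.geometry (Fin 3)) ε n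
        (fun p : T3 × V3 => globalMaxwellian p.2) z := by
  -- adapted from `BoltzmannGreenKuboOrthMomentum.canonicalDensity_const_flow`
  simp only [canonicalDensity]
  rw [Set.indicator_of_mem (Φ.good_subset (Φ.mapsTo_good t hz)),
    Set.indicator_of_mem (Φ.good_subset hz), tensorPow_globalMaxwellian_snd_flow Φ hz t]

/-- **Core invariance lemma** (no positivity hypotheses): the push-forward of the torus canonical Gibbs
law under `Φ.flow t` is itself — Liouville's theorem (`HardSphereFlow.measurePreserving`) plus invariance
of the density on the conull good set. -/
theorem map_flow_torusGibbs (ε : ℝ) (n : ℕ) (Φ : TorusFlow ε n) (t : ℝ) :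
    (torusGibbs ε n Φ).map (Φ.flow t) = torusGibbs ε n Φ := by
  -- adapted from `BoltzmannGreenKuboOrthMomentum.map_flow_localGibbsLaw_const`
  set L := liouville (Literature.Analysis.FluidPDE.Torus.geometry (Fin 3)) n ε with hL
  set ρ : TorusPhase n → ℝ≥0∞ := fun z => ENNReal.ofReal
    (canonicalDensity (Literature.Analysis.FluidPDE.Torus.geometry (Fin 3)) ε n
      (fun p : T3 × V3 => globalMaxwellian p.2) z) with hρ
  have hG : torusGibbs ε n Φ = L.withDensity ρ := by
    simp only [torusGibbs, particleLaw_eq, hL, hρ]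
  have hρm : Measurable ρ :=
    (Literature.MathematicalPhysics.KineticTheory.measurable_canonicalDensity ε n
      (continuous_globalMaxwellian.measurable.comp measurable_snd)).ennreal_ofReal
  rw [hG]
  ext A hA
  rw [Measure.map_apply (Φ.measurable_flow t) hA, withDensity_apply _ (hA.preimage (Φ.measurable_flow t)),
    withDensity_apply _ hA, ← lintegral_indicator (hA.preimage (Φ.measurable_flow t)),
    ← lintegral_indicator hA]
  have key : (fun z => (Φ.flow t ⁻¹' A).indicator ρ z) =ᵐ[L] fun z => (A.indicator ρ) (Φ.flow t z) := by
    filter_upwards [Φ.ae_mem_good] with z hz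
    by_cases h : Φ.flow t z ∈ A
    · rw [Set.indicator_of_mem h, Set.indicator_of_mem (show z ∈ Φ.flow t ⁻¹' A from h), hρ]
      simp only []
      rw [canonicalDensity_globalMaxwellian_flow Φ hz t]
    · rw [Set.indicator_of_notMem h, Set.indicator_of_notMem (show z ∉ Φ.flow t ⁻¹' A from h)]
  rw [lintegral_congr_ae key]
  exact (Φ.measurePreserving t).lintegral_comp (hρm.indicator hA)

/-- **Registered stub `stub_torusGibbsInvariant`: THE TORUS CANONICAL LAW IS FLOW-INVARIANT.** For every
diameter `ε`, particle number `n`, torus hard-sphere flow `Φ` and time `t`,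
`(torusGibbs ε n Φ).map (Φ.flow t) = torusGibbs ε n Φ`. -/
theorem stub_torusGibbsInvariant : TorusGibbsInvariance :=
  fun ε n Φ t => map_flow_torusGibbs ε n Φ t

end TorusGibbsInvariant

end Summit.AtomisticToContinuum.HydrodynamicLimit.Theorems.EntropyBall

end
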